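import Summits.QuantumFields.BalabanUV.Beta.EriceFlowEnclosureB12AsPrintedHistoryContagionShiftFlow

/-!
# Beta / EriceFlowEnclosureB12AsPrintedHistoryContagionShiftFlowPicard — ASYMPTOTIC FREEDOM IS CONTAGIOUS, part 12: THE LATTICE-FREE PICARD ITERATION NEAR ZERO
# PIN — THE SOLUTION MAP AND ITS CONTRACTION.  Node U2's OWN solution scheme for the flow with memory (`T4BetaFlowWellPosed`: `picard B e u m = (1∕e² + Σ_{l<m}
# B(u(l+1), u(l+2), …))^{−1∕2}`, iterated from a start u: `(picard B e)^[n] u`; node U2's `iterate B e n` is the constant start) WORKS FLOOR-FREE near zero pin: a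
# memory profile `MemoryProfile C_m θ γ B` (θ < 1) and ONE box solution t with an asymptotically free profile `1∕t_a² + β*·m ≤ 1∕t(m)²` make the solution map send
# every box history below 2e to a box history below 2e WITH the quarter profile `1∕(4e²) + (β*∕4)m ≤ 1∕(picard B e u)(m)²` (§14 — part 10's contagion for the IMAGE),
# and make the driving sums of two such histories contract in the θ₁-weighted chart distance (§15 — part 10's `sep_propagate` for ARBITRARY enveloped histories), so
# that consecutive iterates differ by `κ^n A₀∕θ₁^q` in the chart, `κ = 8C_m e³∕((1 − θ∕θ₁)(1 − θ₁)) ≤ ½` at θ₁ = (1+θ)∕2 under `64C_m e³ ≤ (1 − θ)²`.  Part 13 passes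
# to the scale-wise limit (existence, node U2's `solution`); part 14 is the two-pin kernel; part 15 reads both on the as-printed carrier from [I] THEOREM 2 AS TYPED.
# Abstract in B (β-flow team, prover 1, unit `b2b-balaban-beta-bflow-p1`, gen 37; ROW AP-I·Uc × NODE U2)

HONEST FRAMING (page 1 of everything the β sub-cell writes): discharging `BetaPertH` makes Bałaban's UV stability UNCONDITIONAL — a
real constructive-QFT result; it is NOT the continuum limit and NOT the Clay problem.  HONEST DEPENDENCY (cell reorg 2026-08-19,
verbatim): «continuum YM on T⁴ ⇐ BetaPertH ∧ nine spine estimates (0/9 proved); BetaPertH ⇐ (D1) ∧ (D4) ∧ CAP+tail; G-an2-4 gates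
asym, D1 and NE2/3/4.»  THIS MODULE DISCHARGES NOTHING: [folklore] real analysis (finite sums, geometric tails of `tsum`s, one Bernoulli inequality) over node U2's HYPOTHESIS
SHAPES `T4BetaStationary.{SeqBox, MemoryProfile}` and `T4BetaFlowWellPosed.{MemFlow, drive, picard}` on an ABSTRACT functional `B : (ℕ → ℝ) → ℝ` — the shapes node U2
derives (`memoryProfile_betaInf`, `memFlow_gstar`) from its NE4 ∕ history-moduli LETTERS (NOT PRINTED for [I] = T. Bałaban, Commun. Math. Phys. **109** (1987)
[Balaban1987RG1]: GAPS G-t4-U2-1 ∕ -2; p. 298 says only that β_j depends on the preceding couplings); the reference profile is the shape of (0.31)'s lower half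
(Theorem 2 p. 259, STATED WITHOUT PROOF) in the continuum, which parts 5 ∕ 6 derive for the limits of pinned families.  Nothing of Bałaban's β is asserted; node U2's
`picard ∕ drive ∕ abs_drive_sub_drive_le` are USED BY NAME, nothing of node U2's modules is restated or modified.

THE POINT.  Node U2's existence (`T4BetaFlowWellPosed` §4) iterates the solution map from the constant history and contracts in the sup distance, the floor `b ≤ B`
turning the linear growth of the driving sums into the AF weight `1∕b`; part 11 got existence of box solutions near zero pin instead as LIMITS OF PINNED LATTICE FAMILIES
(`memFlow_bigBox_of_typedTheorem2`).  Parts 12–13 make existence INTRINSIC and floor-free.  §14 — for a box history u below 2e the base `1∕e² + drive B u m` obeys the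
quarter profile (part 10's `abs_drive_sub_drive_le_of_envelope` against the reference, the square root absorbed by `mul_sprof_le`, the budget `e²Q ≤ 3∕4`; the envelope is
now a hypothesis, not an induction), so `picard B e` maps the class «box, ≤ 2e» into itself with the profile (2e ≤ γ); §15 — the driving sums of two such histories whose
chart separation `|1∕u² − 1∕u′²|` is `≤ A∕θ₁^q` differ by `≤ κA∕θ₁^m` (θ < θ₁ < 1; `|u − u′| ≤ u²u′|Δ| ≤ 8e³|Δ|`, the profile `Σ_j θ^j θ₁^{−(p+1+j)}`, the reversed row
`Σ_{p<m} θ₁^{−(p+1)}`), and along the iteration the chart differences of consecutive iterates are `≤ κ^n A₀∕θ₁^q` from the a-priori LINEAR growth of the SECOND step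
(node U2's `abs_drive_sub_drive_le` with η = 0; Bernoulli `q(1 − θ₁) ≤ θ₁^{−q}`) — whatever the start's own chart values.

WHAT THIS FILE PROVES (0 sorry, 0 def): §14 **`base_lower_of_envelope`**, `invSq_picard`, `picard_pos_of_base_pos`, `picard_at_zero`, **`picard_mem_of_envelope`**; §15
**`picardIter_mem`**, **`picardIter_profile`**, `invSq_picardIter_succ`, **`abs_drive_sub_drive_le_weighted`**, `mul_le_inv_pow`, `kappa_le_half`,
**`abs_invSq_picardIter_succ_sub_le`**.  NOT CLAIMED: anything about Bałaban's β; convergence (part 13); `BetaPertH`; the continuum limit of the measures; Clay.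
-/

namespace Summit.QuantumFields.BalabanUV.Beta.EriceFlowEnclosureB12AsPrintedHistoryContagionShiftFlowPicard

open Finset Filter Topology
open Literature.MathematicalPhysics.QuantumFieldTheory.Balaban1983to89
open Literature.MathematicalPhysics.QuantumFieldTheory.Balaban1983to89.T4CouplingMatching (prof sprof sprof_pos sprof_sq prof_pos abs_sub_le_of_inv_sq)
open Literature.MathematicalPhysics.QuantumFieldTheory.Balaban1983to89.T4BetaStationary (SeqBox MemoryProfile summable_profile abs_sub_le_of_seqBox
  tsum_profile_le)
open Literature.MathematicalPhysics.QuantumFieldTheory.Balaban1983to89.T4BetaFlowWellPosed (MemFlow drive drive_succ drive_zero picard iterate solution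
  iterate_zero iterate_succ seqBox_shift invSq_eq_of_memFlow memFlow_of_invSq_eq one_div_sq_one_div_sqrt one_div_sqrt_one_div_sq abs_drive_sub_drive_le bbar
  drive_le_mul_bbar)
open Summit.QuantumFields.BalabanUV.Beta.EriceFlowEnclosureB12AsPrintedHistoryContagion (mul_sprof_le)
open Summit.QuantumFields.BalabanUV.Beta.EriceFlowEnclosureB12AsPrintedHistoryContagionProfile (le_two_mul_of_profile)
open Summit.QuantumFields.BalabanUV.Beta.EriceFlowEnclosureB12AsPrintedHistoryContagionShiftFlow (le_invSprof_of_prof_le abs_drive_sub_drive_le_of_envelope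
  geom_rev_le memFlow_unique_of_reference)

noncomputable section

/-! ## §14 The solution map near zero pin: the contagion for the image -/

/-- **THE CONTAGION FOR THE SOLUTION MAP.**  `B` with memory profile `(C_m, θ)` on ]0, γ]^ℕ (0 ≤ θ < 1, C_m ≥ 0); ONE box solution t of `MemFlow B g* t` with the AF profile
`1∕t_a² + β*·m ≤ 1∕t(m)²`; a box history u BELOW 2e EVERYWHERE; the pin e with `4C_m e ≤ β*(1 − θ)`, `e²·(1∕g*² + C_mγ∕(1 − θ)² + (2C_m∕((1 − θ)β*))²) ≤ 3∕4`.  THEN the base of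
the solution map obeys the quarter profile: **`1∕(4e²) + (β*∕4)m ≤ 1∕e² + drive B u m`** at every scale m (part 10's induction step, with the envelope now a hypothesis).
[cite: Balaban1987RG1, Thm 2 (0.31) p.259 with (0.20) p.256 and p.298] -/
theorem base_lower_of_envelope {B : (ℕ → ℝ) → ℝ} {Cm θ γ bs ta gs e : ℝ} {t u : ℕ → ℝ}
    (hB : MemoryProfile Cm θ γ B) (hCm : 0 ≤ Cm) (hθ0 : 0 ≤ θ) (hθ1 : θ < 1) (hbs : 0 < bs) (hta : 0 < ta)
    (hts : SeqBox γ t) (htf : MemFlow B gs t) (hprof : ∀ m : ℕ, 1 / ta ^ 2 + bs * (m : ℝ) ≤ 1 / (t m) ^ 2)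
    (he : 0 < e) (hus : SeqBox γ u) (henv : ∀ q, u q ≤ 2 * e)
    (hs1 : 4 * Cm * e ≤ bs * (1 - θ))
    (hs2 : e ^ 2 * (1 / gs ^ 2 + Cm * γ / (1 - θ) ^ 2 + (2 * Cm / ((1 - θ) * bs)) ^ 2) ≤ 3 / 4) (m : ℕ) :
    1 / (4 * e ^ 2) + bs / 4 * (m : ℝ) ≤ 1 / e ^ 2 + drive B u m := by
  have h1θ : 0 < 1 - θ := by linarith
  have hgs : 0 < gs := by rw [← htf.1]; exact (hts 0).1
  have htprof : ∀ q : ℕ, t q ≤ 1 / sprof ta bs q := fun q => le_invSprof_of_prof_le hta hbs.le (hts q).1 (hprof q)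
  have hQ : 1 / gs ^ 2 + Cm * γ / (1 - θ) ^ 2 + (2 * Cm / ((1 - θ) * bs)) ^ 2 ≤ 3 / (4 * e ^ 2) := by
    rw [le_div_iff₀ (by positivity)]; linarith
  have hD := abs_drive_sub_drive_le_of_envelope hB hCm hθ0 hθ1 hbs hta (by positivity : (0 : ℝ) ≤ 2 * e) hus hts htprof
    (m := m) (fun q _ => henv q)
  have hy : 1 / (t m) ^ 2 = 1 / gs ^ 2 + drive B t m := invSq_eq_of_memFlow htf m
  have hyt : 1 / ta ^ 2 + bs * (m : ℝ) - 1 / gs ^ 2 ≤ drive B t m := by linarith [hprof m]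
  have hab := mul_sprof_le hta hbs.le (2 * Cm / ((1 - θ) * bs)) m
  have hprofm : prof ta bs m = 1 / ta ^ 2 + bs * (m : ℝ) := rfl
  have hlin : Cm / (1 - θ) * (2 * e) ≤ bs / 2 := by
    rw [div_mul_eq_mul_div, div_le_iff₀ h1θ]; linarith
  have hlin' : Cm / (1 - θ) * (2 * e * (m : ℝ)) ≤ bs / 2 * (m : ℝ) := by
    calc Cm / (1 - θ) * (2 * e * (m : ℝ)) = Cm / (1 - θ) * (2 * e) * (m : ℝ) := by ring
      _ ≤ bs / 2 * (m : ℝ) := mul_le_mul_of_nonneg_right hlin (Nat.cast_nonneg m)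
  have hsq : Cm / (1 - θ) * (2 / bs * sprof ta bs m) = 2 * Cm / ((1 - θ) * bs) * sprof ta bs m := by
    field_simp
  have hDle := (abs_sub_le_iff.mp hD).2
  have hta2 : 0 ≤ 1 / ta ^ 2 := by positivity
  have hdist : Cm / (1 - θ) * (2 * e * (m : ℝ) + 2 / bs * sprof ta bs m)
      = Cm / (1 - θ) * (2 * e * (m : ℝ)) + Cm / (1 - θ) * (2 / bs * sprof ta bs m) := mul_add _ _ _
  have e14 : 1 / (4 * e ^ 2) = 1 / e ^ 2 - 3 / (4 * e ^ 2) := by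
    field_simp
    ring
  rw [hprofm] at hab
  linarith [hyt, hDle, hab, hlin', hQ, hsq, hdist, e14, hta2]

/-- The chart identity for the image: `1∕(picard B e u m)² = 1∕e² + drive B u m` once the base is positive. [folklore] -/
theorem invSq_picard {B : (ℕ → ℝ) → ℝ} {e : ℝ} {u : ℕ → ℝ} {m : ℕ} (hS : 0 < 1 / e ^ 2 + drive B u m) :
    1 / (picard B e u m) ^ 2 = 1 / e ^ 2 + drive B u m := by
  unfold T4BetaFlowWellPosed.picard
  exact one_div_sq_one_div_sqrt hS

/-- The image is positive once the base is positive. [folklore] -/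
theorem picard_pos_of_base_pos {B : (ℕ → ℝ) → ℝ} {e : ℝ} {u : ℕ → ℝ} {m : ℕ} (hS : 0 < 1 / e ^ 2 + drive B u m) :
    0 < picard B e u m := by
  unfold T4BetaFlowWellPosed.picard
  exact one_div_pos.mpr (Real.sqrt_pos.mpr hS)

/-- The image is pinned at e: `picard B e u 0 = e` (e > 0). [folklore] -/
theorem picard_at_zero {B : (ℕ → ℝ) → ℝ} {e : ℝ} (he : 0 < e) (u : ℕ → ℝ) : picard B e u 0 = e := by
  unfold T4BetaFlowWellPosed.picard
  rw [drive_zero, add_zero]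
  exact one_div_sqrt_one_div_sq he

/-- **THE SOLUTION MAP PRESERVES THE CLASS «box-valued, below 2e» AND PRODUCES THE QUARTER PROFILE** (2e ≤ γ): for u as in `base_lower_of_envelope`, `picard B e u` is
box-valued, `1∕(4e²) + (β*∕4)m ≤ 1∕(picard B e u m)²` for all m, and `picard B e u ≤ 2e`.  No floor ∕ sign on B. [cite: Balaban1987RG1, Thm 2 (0.31) p.259 with (0.20) p.256] -/
theorem picard_mem_of_envelope {B : (ℕ → ℝ) → ℝ} {Cm θ γ bs ta gs e : ℝ} {t u : ℕ → ℝ}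
    (hB : MemoryProfile Cm θ γ B) (hCm : 0 ≤ Cm) (hθ0 : 0 ≤ θ) (hθ1 : θ < 1) (hbs : 0 < bs) (hta : 0 < ta)
    (hts : SeqBox γ t) (htf : MemFlow B gs t) (hprof : ∀ m : ℕ, 1 / ta ^ 2 + bs * (m : ℝ) ≤ 1 / (t m) ^ 2)
    (he : 0 < e) (h2e : 2 * e ≤ γ) (hus : SeqBox γ u) (henv : ∀ q, u q ≤ 2 * e)
    (hs1 : 4 * Cm * e ≤ bs * (1 - θ))
    (hs2 : e ^ 2 * (1 / gs ^ 2 + Cm * γ / (1 - θ) ^ 2 + (2 * Cm / ((1 - θ) * bs)) ^ 2) ≤ 3 / 4) :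
    SeqBox γ (picard B e u) ∧ (∀ m : ℕ, 1 / (4 * e ^ 2) + bs / 4 * (m : ℝ) ≤ 1 / (picard B e u m) ^ 2) ∧
      ∀ q, picard B e u q ≤ 2 * e := by
  have hbase := base_lower_of_envelope hB hCm hθ0 hθ1 hbs hta hts htf hprof he hus henv hs1 hs2
  have hS : ∀ m : ℕ, 0 < 1 / e ^ 2 + drive B u m := fun m =>
    (by positivity : (0 : ℝ) < 1 / (4 * e ^ 2) + bs / 4 * (m : ℝ)).trans_le (hbase m)
  have hprof' : ∀ m : ℕ, 1 / (4 * e ^ 2) + bs / 4 * (m : ℝ) ≤ 1 / (picard B e u m) ^ 2 := fun m => by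
    rw [invSq_picard (hS m)]; exact hbase m
  have hpos : ∀ m, 0 < picard B e u m := fun m => picard_pos_of_base_pos (hS m)
  have hle : ∀ q, picard B e u q ≤ 2 * e := fun q =>
    le_two_mul_of_profile hbs.le he (hpos q) (Nat.cast_nonneg q) (hprof' q)
  exact ⟨fun q => ⟨hpos q, (hle q).trans h2e⟩, hprof', hle⟩

/-! ## §15 The iterates from an enveloped start: invariance and the θ₁-weighted contraction of the driving sums -/

/-- **EVERY ITERATE IS BOX-VALUED AND BELOW 2e** from a start that is. [folklore] -/
theorem picardIter_mem {B : (ℕ → ℝ) → ℝ} {Cm θ γ bs ta gs e : ℝ} {t u : ℕ → ℝ}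
    (hB : MemoryProfile Cm θ γ B) (hCm : 0 ≤ Cm) (hθ0 : 0 ≤ θ) (hθ1 : θ < 1) (hbs : 0 < bs) (hta : 0 < ta)
    (hts : SeqBox γ t) (htf : MemFlow B gs t) (hprof : ∀ m : ℕ, 1 / ta ^ 2 + bs * (m : ℝ) ≤ 1 / (t m) ^ 2)
    (he : 0 < e) (h2e : 2 * e ≤ γ) (hus : SeqBox γ u) (henv : ∀ q, u q ≤ 2 * e)
    (hs1 : 4 * Cm * e ≤ bs * (1 - θ))
    (hs2 : e ^ 2 * (1 / gs ^ 2 + Cm * γ / (1 - θ) ^ 2 + (2 * Cm / ((1 - θ) * bs)) ^ 2) ≤ 3 / 4) :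
    ∀ n : ℕ, SeqBox γ ((picard B e)^[n] u) ∧ ∀ q, (picard B e)^[n] u q ≤ 2 * e := by
  intro n
  induction n with
  | zero => exact ⟨hus, henv⟩
  | succ n ih =>
    rw [Function.iterate_succ_apply']
    have h := picard_mem_of_envelope hB hCm hθ0 hθ1 hbs hta hts htf hprof he h2e ih.1 ih.2 hs1 hs2
    exact ⟨h.1, h.2.2⟩

/-- **FROM THE FIRST STEP ON, EVERY ITERATE CARRIES THE QUARTER PROFILE** `1∕(4e²) + (β*∕4)m ≤ 1∕((picard B e)^[n+1] u)(m)²`. [cite: Balaban1987RG1, Thm 2 (0.31) p.259] -/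
theorem picardIter_profile {B : (ℕ → ℝ) → ℝ} {Cm θ γ bs ta gs e : ℝ} {t u : ℕ → ℝ}
    (hB : MemoryProfile Cm θ γ B) (hCm : 0 ≤ Cm) (hθ0 : 0 ≤ θ) (hθ1 : θ < 1) (hbs : 0 < bs) (hta : 0 < ta)
    (hts : SeqBox γ t) (htf : MemFlow B gs t) (hprof : ∀ m : ℕ, 1 / ta ^ 2 + bs * (m : ℝ) ≤ 1 / (t m) ^ 2)
    (he : 0 < e) (h2e : 2 * e ≤ γ) (hus : SeqBox γ u) (henv : ∀ q, u q ≤ 2 * e)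
    (hs1 : 4 * Cm * e ≤ bs * (1 - θ))
    (hs2 : e ^ 2 * (1 / gs ^ 2 + Cm * γ / (1 - θ) ^ 2 + (2 * Cm / ((1 - θ) * bs)) ^ 2) ≤ 3 / 4) (n m : ℕ) :
    1 / (4 * e ^ 2) + bs / 4 * (m : ℝ) ≤ 1 / ((picard B e)^[n + 1] u m) ^ 2 := by
  rw [Function.iterate_succ_apply']
  have ih := picardIter_mem hB hCm hθ0 hθ1 hbs hta hts htf hprof he h2e hus henv hs1 hs2 n
  exact (picard_mem_of_envelope hB hCm hθ0 hθ1 hbs hta hts htf hprof he h2e ih.1 ih.2 hs1 hs2).2.1 m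

/-- The chart identity along the iteration: `1∕((picard B e)^[n+1] u)(m)² = 1∕e² + drive B ((picard B e)^[n] u) m`. [folklore] -/
theorem invSq_picardIter_succ {B : (ℕ → ℝ) → ℝ} {Cm θ γ bs ta gs e : ℝ} {t u : ℕ → ℝ}
    (hB : MemoryProfile Cm θ γ B) (hCm : 0 ≤ Cm) (hθ0 : 0 ≤ θ) (hθ1 : θ < 1) (hbs : 0 < bs) (hta : 0 < ta)
    (hts : SeqBox γ t) (htf : MemFlow B gs t) (hprof : ∀ m : ℕ, 1 / ta ^ 2 + bs * (m : ℝ) ≤ 1 / (t m) ^ 2)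
    (he : 0 < e) (h2e : 2 * e ≤ γ) (hus : SeqBox γ u) (henv : ∀ q, u q ≤ 2 * e)
    (hs1 : 4 * Cm * e ≤ bs * (1 - θ))
    (hs2 : e ^ 2 * (1 / gs ^ 2 + Cm * γ / (1 - θ) ^ 2 + (2 * Cm / ((1 - θ) * bs)) ^ 2) ≤ 3 / 4) (n m : ℕ) :
    1 / ((picard B e)^[n + 1] u m) ^ 2 = 1 / e ^ 2 + drive B ((picard B e)^[n] u) m := by
  rw [Function.iterate_succ_apply']
  have ih := picardIter_mem hB hCm hθ0 hθ1 hbs hta hts htf hprof he h2e hus henv hs1 hs2 n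
  have hbase := base_lower_of_envelope hB hCm hθ0 hθ1 hbs hta hts htf hprof he ih.1 ih.2 hs1 hs2 m
  exact invSq_picard ((by positivity : (0 : ℝ) < 1 / (4 * e ^ 2) + bs / 4 * (m : ℝ)).trans_le hbase)

/-- **THE θ₁-WEIGHTED CONTRACTION OF THE DRIVING SUMS** (part 10's `sep_propagate` for ARBITRARY box histories below 2e): `B` with memory profile `(C_m, θ)`, a second rate
`θ < θ₁ < 1`, two box histories u, u′ ≤ 2e with `|1∕u(q)² − 1∕u′(q)²| ≤ A∕θ₁^q` for all q.  Then for all m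
`|drive B u m − drive B u′ m| ≤ κ·A∕θ₁^m`, `κ = 8C_m e³∕((1 − θ∕θ₁)(1 − θ₁))` (`|u − u′| ≤ u²u′|Δ| ≤ 8e³|Δ|`, `Σ_j θ^j θ₁^{−(p+1+j)} = θ₁^{−(p+1)}∕(1 − θ∕θ₁)`,
`Σ_{p<m} θ₁^{−(p+1)} ≤ θ₁^{−m}∕(1 − θ₁)`). [folklore] -/
theorem abs_drive_sub_drive_le_weighted {B : (ℕ → ℝ) → ℝ} {Cm θ θ₁ γ e A : ℝ} {u u' : ℕ → ℝ}
    (hB : MemoryProfile Cm θ γ B) (hCm : 0 ≤ Cm) (hθ0 : 0 ≤ θ) (hθθ₁ : θ < θ₁) (hθ₁1 : θ₁ < 1) (he : 0 ≤ e)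
    (hus : SeqBox γ u) (hus' : SeqBox γ u') (henv : ∀ q, u q ≤ 2 * e) (henv' : ∀ q, u' q ≤ 2 * e)
    (hA : ∀ q : ℕ, |1 / (u q) ^ 2 - 1 / (u' q) ^ 2| ≤ A / θ₁ ^ q) (m : ℕ) :
    |drive B u m - drive B u' m| ≤ 8 * Cm * e ^ 3 / ((1 - θ / θ₁) * (1 - θ₁)) * A / θ₁ ^ m := by
  have hθ₁0 : 0 < θ₁ := lt_of_le_of_lt hθ0 hθθ₁
  have hr0 : 0 ≤ θ / θ₁ := div_nonneg hθ0 hθ₁0.le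
  have hr1 : θ / θ₁ < 1 := (div_lt_one hθ₁0).mpr hθθ₁
  have h1r : 0 < 1 - θ / θ₁ := by linarith
  have h1θ₁ : 0 < 1 - θ₁ := by linarith
  have hA0 : 0 ≤ A := by
    have h0 := hA 0
    rw [pow_zero, div_one] at h0
    exact (abs_nonneg _).trans h0
  -- one memory term
  have hterm : ∀ p : ℕ, |B (fun j => u (p + 1 + j)) - B (fun j => u' (p + 1 + j))|
      ≤ Cm * (8 * e ^ 3 * A / (1 - θ / θ₁) * (1 / θ₁ ^ (p + 1))) := by
    intro p
    have hs := summable_profile hθ0 (hθθ₁.trans hθ₁1) (seqBox_shift hus (p + 1)) (seqBox_shift hus' (p + 1))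
    have hg : Summable fun j : ℕ => (8 * e ^ 3 * A * (1 / θ₁ ^ (p + 1))) * (θ / θ₁) ^ j :=
      (summable_geometric_of_lt_one hr0 hr1).mul_left _
    refine (hB _ _ (seqBox_shift hus (p + 1)) (seqBox_shift hus' (p + 1))).trans (mul_le_mul_of_nonneg_left ?_ hCm)
    calc ∑' j, θ ^ j * |u (p + 1 + j) - u' (p + 1 + j)| ≤ ∑' j : ℕ, (8 * e ^ 3 * A * (1 / θ₁ ^ (p + 1))) * (θ / θ₁) ^ j := by
          refine hs.tsum_le_tsum (fun j => ?_) hg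
          have hq := (hus (p + 1 + j)).1
          have hq' := (hus' (p + 1 + j)).1
          have hw : (u (p + 1 + j)) ^ 2 * u' (p + 1 + j) ≤ 8 * e ^ 3 := by
            have h1 : (u (p + 1 + j)) ^ 2 ≤ (2 * e) ^ 2 := pow_le_pow_left₀ hq.le (henv _) 2
            calc (u (p + 1 + j)) ^ 2 * u' (p + 1 + j) ≤ (2 * e) ^ 2 * (2 * e) := mul_le_mul h1 (henv' _) hq'.le (by positivity)
              _ = 8 * e ^ 3 := by ring
          have hd : |u (p + 1 + j) - u' (p + 1 + j)| ≤ 8 * e ^ 3 * (A / θ₁ ^ (p + 1 + j)) :=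
            (abs_sub_le_of_inv_sq hq hq').trans (mul_le_mul hw (hA _) (abs_nonneg _) (by positivity))
          have e1 : θ ^ j * (8 * e ^ 3 * (A / θ₁ ^ (p + 1 + j))) = 8 * e ^ 3 * A * (1 / θ₁ ^ (p + 1)) * (θ / θ₁) ^ j := by
            rw [div_pow, pow_add]; field_simp
          calc θ ^ j * |u (p + 1 + j) - u' (p + 1 + j)| ≤ θ ^ j * (8 * e ^ 3 * (A / θ₁ ^ (p + 1 + j))) :=
                mul_le_mul_of_nonneg_left hd (pow_nonneg hθ0 j)
            _ = 8 * e ^ 3 * A * (1 / θ₁ ^ (p + 1)) * (θ / θ₁) ^ j := e1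
      _ = 8 * e ^ 3 * A * (1 / θ₁ ^ (p + 1)) * ∑' j : ℕ, (θ / θ₁) ^ j := tsum_mul_left
      _ = 8 * e ^ 3 * A / (1 - θ / θ₁) * (1 / θ₁ ^ (p + 1)) := by
          rw [tsum_geometric_of_lt_one hr0 hr1]; field_simp
  -- the reversed geometric row in 1/θ₁
  have hrow : ∀ m : ℕ, ∑ p ∈ range m, 1 / θ₁ ^ (p + 1) ≤ 1 / θ₁ ^ m / (1 - θ₁) := by
    intro m
    have e1 : ∑ p ∈ range m, 1 / θ₁ ^ (p + 1) = 1 / θ₁ ^ m * ∑ p ∈ range m, θ₁ ^ (m - 1 - p) := by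
      rw [Finset.mul_sum]
      refine Finset.sum_congr rfl fun p hp => ?_
      have hpm : p + 1 ≤ m := mem_range.mp hp
      have e2 : θ₁ ^ m = θ₁ ^ (p + 1) * θ₁ ^ (m - 1 - p) := by rw [← pow_add]; congr 1; omega
      rw [e2]; field_simp
    rw [e1, div_eq_mul_one_div (1 / θ₁ ^ m)]
    exact mul_le_mul_of_nonneg_left (geom_rev_le hθ₁0.le hθ₁1 m) (by positivity)
  unfold T4BetaFlowWellPosed.drive
  rw [← Finset.sum_sub_distrib]
  calc |∑ p ∈ range m, (B (fun j => u (p + 1 + j)) - B (fun j => u' (p + 1 + j)))|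
      ≤ ∑ p ∈ range m, |B (fun j => u (p + 1 + j)) - B (fun j => u' (p + 1 + j))| := Finset.abs_sum_le_sum_abs _ _
    _ ≤ ∑ p ∈ range m, Cm * (8 * e ^ 3 * A / (1 - θ / θ₁) * (1 / θ₁ ^ (p + 1))) := Finset.sum_le_sum fun p _ => hterm p
    _ = Cm * (8 * e ^ 3 * A / (1 - θ / θ₁)) * ∑ p ∈ range m, 1 / θ₁ ^ (p + 1) := by
        rw [Finset.mul_sum]; refine Finset.sum_congr rfl fun p _ => by ring
    _ ≤ Cm * (8 * e ^ 3 * A / (1 - θ / θ₁)) * (1 / θ₁ ^ m / (1 - θ₁)) := mul_le_mul_of_nonneg_left (hrow m) (by positivity)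
    _ = 8 * Cm * e ^ 3 / ((1 - θ / θ₁) * (1 - θ₁)) * A / θ₁ ^ m := by
        field_simp

/-- Bernoulli in the form used: `q·(1 − θ₁) ≤ θ₁^{−q}` (0 < θ₁ < 1). [folklore] -/
theorem mul_le_inv_pow {θ₁ : ℝ} (hθ₁0 : 0 < θ₁) (hθ₁1 : θ₁ < 1) (q : ℕ) : (q : ℝ) * (1 - θ₁) ≤ 1 / θ₁ ^ q := by
  have h1θ₁0 : 0 < 1 - θ₁ := by linarith
  have hb := one_add_mul_le_pow (a := 1 / θ₁ - 1) (by rw [le_sub_iff_add_le]; linarith [(one_le_one_div hθ₁0 hθ₁1.le)]) q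
  rw [show 1 + (1 / θ₁ - 1) = 1 / θ₁ by ring, one_div_pow] at hb
  have e1 : (q : ℝ) * (1 / θ₁ - 1) = (q : ℝ) * (1 - θ₁) / θ₁ := by field_simp
  rw [e1] at hb
  have h2 : (q : ℝ) * (1 - θ₁) ≤ (q : ℝ) * (1 - θ₁) / θ₁ := by
    rw [le_div_iff₀ hθ₁0]
    have hq0 : (0 : ℝ) ≤ (q : ℝ) * (1 - θ₁) := mul_nonneg (Nat.cast_nonneg q) h1θ₁0.le
    nlinarith
  linarith

/-- THE SECOND RATE θ₁ = (1+θ)∕2 AND THE CONTRACTION FACTOR: under `64C_m e³ ≤ (1 − θ)²`, `θ < θ₁ < 1` and `0 ≤ κ ≤ ½` for `κ = 8C_m e³∕((1 − θ∕θ₁)(1 − θ₁))`. [folklore] -/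
theorem kappa_le_half {Cm θ e : ℝ} (hCm : 0 ≤ Cm) (hθ0 : 0 ≤ θ) (hθ1 : θ < 1) (he : 0 ≤ e) (hs4 : 64 * Cm * e ^ 3 ≤ (1 - θ) ^ 2) :
    θ < (1 + θ) / 2 ∧ (1 + θ) / 2 < 1 ∧ 0 ≤ 8 * Cm * e ^ 3 / ((1 - θ / ((1 + θ) / 2)) * (1 - (1 + θ) / 2)) ∧
      8 * Cm * e ^ 3 / ((1 - θ / ((1 + θ) / 2)) * (1 - (1 + θ) / 2)) ≤ 1 / 2 := by
  set θ₁ : ℝ := (1 + θ) / 2 with hθ₁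
  have hθθ₁ : θ < θ₁ := by rw [hθ₁]; linarith
  have hθ₁1 : θ₁ < 1 := by rw [hθ₁]; linarith
  have hθ₁0 : 0 < θ₁ := lt_of_le_of_lt hθ0 hθθ₁
  have h1θ₁ : 1 - θ₁ = (1 - θ) / 2 := by rw [hθ₁]; ring
  have h1r : (1 - θ) / 2 ≤ 1 - θ / θ₁ := by
    have : θ / θ₁ ≤ (1 + θ) / 2 := by
      rw [div_le_iff₀ hθ₁0, hθ₁]; nlinarith [sq_nonneg (1 - θ)]
    linarith
  have h1r0 : 0 < 1 - θ / θ₁ := by linarith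
  have h1θ₁0 : 0 < 1 - θ₁ := by linarith
  refine ⟨hθθ₁, hθ₁1, div_nonneg (by positivity) (mul_nonneg h1r0.le h1θ₁0.le), ?_⟩
  rw [div_le_iff₀ (mul_pos h1r0 h1θ₁0), h1θ₁]
  have hprod : (1 - θ) / 2 * ((1 - θ) / 2) ≤ (1 - θ / θ₁) * ((1 - θ) / 2) :=
    mul_le_mul_of_nonneg_right h1r (by linarith)
  nlinarith

/-- **CONSECUTIVE ITERATES CONTRACT IN THE WEIGHTED CHART**: from an enveloped start, for every second rate `θ < θ₁ < 1` and all n, q: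
`|1∕((picard B e)^[n+2] u)(q)² − 1∕((picard B e)^[n+1] u)(q)²| ≤ κ^n·A₀∕θ₁^q`, `A₀ = C_mγ∕((1 − θ)(1 − θ₁))` (the a-priori linear growth of the SECOND step — node U2's
`abs_drive_sub_drive_le` — under Bernoulli; then `abs_drive_sub_drive_le_weighted`). [folklore] -/
theorem abs_invSq_picardIter_succ_sub_le {B : (ℕ → ℝ) → ℝ} {Cm θ θ₁ γ bs ta gs e : ℝ} {t u : ℕ → ℝ}
    (hB : MemoryProfile Cm θ γ B) (hCm : 0 ≤ Cm) (hθ0 : 0 ≤ θ) (hθ1 : θ < 1) (hbs : 0 < bs) (hta : 0 < ta)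
    (hts : SeqBox γ t) (htf : MemFlow B gs t) (hprof : ∀ m : ℕ, 1 / ta ^ 2 + bs * (m : ℝ) ≤ 1 / (t m) ^ 2)
    (he : 0 < e) (h2e : 2 * e ≤ γ) (hus : SeqBox γ u) (henv : ∀ q, u q ≤ 2 * e)
    (hs1 : 4 * Cm * e ≤ bs * (1 - θ))
    (hs2 : e ^ 2 * (1 / gs ^ 2 + Cm * γ / (1 - θ) ^ 2 + (2 * Cm / ((1 - θ) * bs)) ^ 2) ≤ 3 / 4)
    (hθθ₁ : θ < θ₁) (hθ₁1 : θ₁ < 1) :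
    ∀ n q : ℕ, |1 / ((picard B e)^[n + 2] u q) ^ 2 - 1 / ((picard B e)^[n + 1] u q) ^ 2|
      ≤ (8 * Cm * e ^ 3 / ((1 - θ / θ₁) * (1 - θ₁))) ^ n * (Cm * (γ / (1 - θ)) / (1 - θ₁)) / θ₁ ^ q := by
  have hmem := picardIter_mem hB hCm hθ0 hθ1 hbs hta hts htf hprof he h2e hus henv hs1 hs2
  have hinv := invSq_picardIter_succ hB hCm hθ0 hθ1 hbs hta hts htf hprof he h2e hus henv hs1 hs2
  have hθ₁0 : 0 < θ₁ := lt_of_le_of_lt hθ0 hθθ₁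
  have h1θ₁ : 0 < 1 - θ₁ := by linarith
  have h1θ : 0 < 1 - θ := by linarith
  have hγ : 0 ≤ γ := (hus 0).1.le.trans (hus 0).2
  have hA₀0 : 0 ≤ Cm * (γ / (1 - θ)) / (1 - θ₁) := by positivity
  intro n
  induction n with
  | zero =>
    intro q
    rw [hinv 1 q, hinv 0 q, add_sub_add_left_eq_sub, pow_zero, one_mul]
    have h := abs_drive_sub_drive_le (B' := B) (η := 0) hB hCm hθ0 hθ1 (fun v _ => by simp) (hmem 1).1 (hmem 0).1
      (D := γ) (fun i => abs_sub_le_of_seqBox (hmem 1).1 (hmem 0).1 i) q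
    rw [add_zero] at h
    calc |drive B ((picard B e)^[1] u) q - drive B ((picard B e)^[0] u) q| ≤ (q : ℝ) * (Cm * (γ / (1 - θ))) := h
      _ = ((q : ℝ) * (1 - θ₁)) * (Cm * (γ / (1 - θ)) / (1 - θ₁)) := by field_simp
      _ ≤ (1 / θ₁ ^ q) * (Cm * (γ / (1 - θ)) / (1 - θ₁)) := mul_le_mul_of_nonneg_right (mul_le_inv_pow hθ₁0 hθ₁1 q) hA₀0
      _ = Cm * (γ / (1 - θ)) / (1 - θ₁) / θ₁ ^ q := by ring
  | succ n ih =>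
    intro q
    rw [show n + 1 + 2 = n + 2 + 1 from rfl, hinv (n + 2) q, hinv (n + 1) q, add_sub_add_left_eq_sub]
    have hp := abs_drive_sub_drive_le_weighted hB hCm hθ0 hθθ₁ hθ₁1 he.le (hmem (n + 2)).1 (hmem (n + 1)).1 (hmem (n + 2)).2
      (hmem (n + 1)).2 ih q
    calc |drive B ((picard B e)^[n + 2] u) q - drive B ((picard B e)^[n + 1] u) q|
        ≤ 8 * Cm * e ^ 3 / ((1 - θ / θ₁) * (1 - θ₁)) * ((8 * Cm * e ^ 3 / ((1 - θ / θ₁) * (1 - θ₁))) ^ n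
            * (Cm * (γ / (1 - θ)) / (1 - θ₁))) / θ₁ ^ q := hp
      _ = (8 * Cm * e ^ 3 / ((1 - θ / θ₁) * (1 - θ₁))) ^ (n + 1) * (Cm * (γ / (1 - θ)) / (1 - θ₁)) / θ₁ ^ q := by
          rw [pow_succ]; ring

/-- … hence IN THE COUPLING CHART consecutive iterates are `(8e³A₀∕θ₁^q)·κ^n`-close at scale q (`|u − u′| ≤ u²u′·|1∕u² − 1∕u′²| ≤ 8e³·|Δ|`). [folklore] -/
theorem dist_picardIter_succ_le {B : (ℕ → ℝ) → ℝ} {Cm θ θ₁ γ bs ta gs e : ℝ} {t u : ℕ → ℝ}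
    (hB : MemoryProfile Cm θ γ B) (hCm : 0 ≤ Cm) (hθ0 : 0 ≤ θ) (hθ1 : θ < 1) (hbs : 0 < bs) (hta : 0 < ta)
    (hts : SeqBox γ t) (htf : MemFlow B gs t) (hprof : ∀ m : ℕ, 1 / ta ^ 2 + bs * (m : ℝ) ≤ 1 / (t m) ^ 2)
    (he : 0 < e) (h2e : 2 * e ≤ γ) (hus : SeqBox γ u) (henv : ∀ q, u q ≤ 2 * e)
    (hs1 : 4 * Cm * e ≤ bs * (1 - θ))
    (hs2 : e ^ 2 * (1 / gs ^ 2 + Cm * γ / (1 - θ) ^ 2 + (2 * Cm / ((1 - θ) * bs)) ^ 2) ≤ 3 / 4)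
    (hθθ₁ : θ < θ₁) (hθ₁1 : θ₁ < 1) (q n : ℕ) :
    dist ((picard B e)^[n + 1] u q) ((picard B e)^[n + 1 + 1] u q)
      ≤ (8 * e ^ 3 * (Cm * (γ / (1 - θ)) / (1 - θ₁)) / θ₁ ^ q) * (8 * Cm * e ^ 3 / ((1 - θ / θ₁) * (1 - θ₁))) ^ n := by
  have hmem := picardIter_mem hB hCm hθ0 hθ1 hbs hta hts htf hprof he h2e hus henv hs1 hs2
  have hdiff := abs_invSq_picardIter_succ_sub_le hB hCm hθ0 hθ1 hbs hta hts htf hprof he h2e hus henv hs1 hs2 hθθ₁ hθ₁1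
  have hθ₁0 : 0 < θ₁ := lt_of_le_of_lt hθ0 hθθ₁
  have hr1 : θ / θ₁ < 1 := (div_lt_one hθ₁0).mpr hθθ₁
  have h1r : 0 < 1 - θ / θ₁ := by linarith
  have h1θ₁ : 0 < 1 - θ₁ := by linarith
  have h1θ : 0 < 1 - θ := by linarith
  have hγ : 0 ≤ γ := (hus 0).1.le.trans (hus 0).2
  have hκ0 : 0 ≤ 8 * Cm * e ^ 3 / ((1 - θ / θ₁) * (1 - θ₁)) := by positivity
  rw [Real.dist_eq]
  have ha := ((hmem (n + 1)).1 q).1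
  have hb := ((hmem (n + 1 + 1)).1 q).1
  have hw : ((picard B e)^[n + 1] u q) ^ 2 * (picard B e)^[n + 1 + 1] u q ≤ 8 * e ^ 3 := by
    have h1 : ((picard B e)^[n + 1] u q) ^ 2 ≤ (2 * e) ^ 2 := pow_le_pow_left₀ ha.le ((hmem (n + 1)).2 q) 2
    calc ((picard B e)^[n + 1] u q) ^ 2 * (picard B e)^[n + 1 + 1] u q ≤ (2 * e) ^ 2 * (2 * e) :=
          mul_le_mul h1 ((hmem (n + 1 + 1)).2 q) hb.le (by positivity)
      _ = 8 * e ^ 3 := by ring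
  have hd : |1 / ((picard B e)^[n + 1] u q) ^ 2 - 1 / ((picard B e)^[n + 1 + 1] u q) ^ 2|
      ≤ (8 * Cm * e ^ 3 / ((1 - θ / θ₁) * (1 - θ₁))) ^ n * (Cm * (γ / (1 - θ)) / (1 - θ₁)) / θ₁ ^ q := by
    rw [abs_sub_comm]; exact hdiff n q
  calc |(picard B e)^[n + 1] u q - (picard B e)^[n + 1 + 1] u q|
      ≤ ((picard B e)^[n + 1] u q) ^ 2 * (picard B e)^[n + 1 + 1] u q
          * |1 / ((picard B e)^[n + 1] u q) ^ 2 - 1 / ((picard B e)^[n + 1 + 1] u q) ^ 2| := abs_sub_le_of_inv_sq ha hb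
    _ ≤ 8 * e ^ 3 * ((8 * Cm * e ^ 3 / ((1 - θ / θ₁) * (1 - θ₁))) ^ n * (Cm * (γ / (1 - θ)) / (1 - θ₁)) / θ₁ ^ q) :=
        mul_le_mul hw hd (abs_nonneg _) (by positivity)
    _ = (8 * e ^ 3 * (Cm * (γ / (1 - θ)) / (1 - θ₁)) / θ₁ ^ q) * (8 * Cm * e ^ 3 / ((1 - θ / θ₁) * (1 - θ₁))) ^ n := by ring

end

end Summit.QuantumFields.BalabanUV.Beta.EriceFlowEnclosureB12AsPrintedHistoryContagionShiftFlowPicard
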